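import Mathlib
import Summits.Ventures.PercRepro2.HCov
import Summits.Ventures.PercRepro2.RootLeafUHalf
import Summits.Ventures.PercRepro2.RootLeafUTheorem
import Summits.Ventures.PercRepro2.RootLeafUCoinGraph
import Summits.Ventures.PercRepro2.RootLeafUCoinShare
import Summits.Ventures.PercRepro2.RootLeafUCoinK
import Summits.Ventures.PercRepro2.RootLeafUCoinL

/-!
# (G4-u) on the coin class: (HCOV) for a root pendant at an unmarked vertex `u` when `b` is adjacent
exactly to `{a₂, u}` (blind cell PercRepro2, p4 g15; S3 (G4-u) item (ab); no definitions)

The class: the root `a₁` is a leaf at the unmarked vertex `u` (edge `f`), and the mark `b` carries exactly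
the two edges `f₁ = {b, a₂}` and `f₂ = {b, u}` — `b` sits between the two roots `u, a₂` of the smaller
instance `(o, u, a₂, c, b)`.  Both halves of the second coefficient of the root-leaf cubic are theorems
there (`Coin.T2oK_nonneg_coin`, `Coin.T2oL_nonneg_coin`: the `b`-coins are independent of the rest of the
configuration on `Q = {u ↮ a₂}`, so both mixed covariances of (MIX-K)/(MIX-L) collapse onto BHK slacks with
the exact shares `ρ_K/N`, `ρ_L/N`, and the one payer `Λ ≥ 0` closes both sides), hence

* **`T2_nonneg_coin`**: `0 ≤ T2` — W1 of (G4-u) on the class, UNCONDITIONALLY;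
* **`HCov_root_leaf_u_of_coin`**: (HCOV) at `(o, a₁, a₂, c, b)` from (HCOV) at `(o, u, a₂, c, b)`, for every
  leaf weight and every weight vector (`HCov_root_leaf_u_of` of RootLeafUTheorem with `T1 ≥ 0`).

This class contains the equality family of (MIX-K) («`b` a leaf at `a₂`», `p₂ = 0`) and its perturbations
in the `(u, b)`-weight — the family on which the marginal class theorems of RootLeafUMixHbClass are not
sufficient (the engine's smallest K-side witness `G = 0–1 0–2 1–5 2–4 3–4 3–5 4–5`,
weights `(63, 1, 63, 1, 6, 63, 6)/64`, `(u, a₂, o, b, c) = (2, 1, 5, 0, 3)` lies in it: `b = 0` is adjacent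
exactly to `a₂ = 1` and `u = 2`).
-/

namespace Summit.Ventures.PercRepro2

open UnionCluster CovForm

namespace RootLeafU

namespace Coin

variable {V : Type*} {E : Type*} [Fintype E] [DecidableEq E] [Fintype V] [DecidableEq V]
  {R : Type*} [Field R] [LinearOrder R] [IsStrictOrderedRing R]

section Theorem

variable (p : E → R) (ends : E → Sym2 V) (o a₂ c b u : V) {f₁ f₂ : E}

/-- **W1 on the coin class**: `0 ≤ T2` when `b` is adjacent exactly to `{a₂, u}`. -/
theorem T2_nonneg_coin (hp : IsProbVec p) (hf₁ : ends f₁ = s(b, a₂)) (hf₂ : ends f₂ = s(b, u))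
    (hb2 : ∀ e, b ∈ ends e → e = f₁ ∨ e = f₂) (hba : b ≠ a₂) (hbu : b ≠ u) (hne : f₁ ≠ f₂)
    (hbo : b ≠ o) (hbc : b ≠ c) : 0 ≤ T2 p ends o a₂ c b u :=
  T2_nonneg_of_halves p ends o a₂ c b u
    (T2oL_nonneg_coin p ends o a₂ c b u hp hf₁ hf₂ hb2 hba hbu hne hbo hbc)
    (T2oK_nonneg_coin p ends o a₂ c b u hp hf₁ hf₂ hb2 hba hbu hne hbo hbc)

/-- **(G4-u) on the coin class**: (HCOV) for a root `a₁` pendant at the unmarked `u` follows from (HCOV) at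
the smaller instance `(o, u, a₂, c, b)` whenever `b` is adjacent exactly to `{a₂, u}` — for every leaf
weight and every weight vector. -/
theorem HCov_root_leaf_u_of_coin (hp : IsProbVec p) {f : E} {a₁ : V} (hf : ends f = s(a₁, u))
    (hleaf : ∀ e, a₁ ∈ ends e → e = f) (h1u : a₁ ≠ u) (h12 : a₁ ≠ a₂) (h1c : a₁ ≠ c)
    (h1o : a₁ ≠ o) (h1b : a₁ ≠ b)
    (hf₁ : ends f₁ = s(b, a₂)) (hf₂ : ends f₂ = s(b, u)) (hb2 : ∀ e, b ∈ ends e → e = f₁ ∨ e = f₂)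
    (hba : b ≠ a₂) (hbu : b ≠ u) (hne : f₁ ≠ f₂) (hbo : b ≠ o) (hbc : b ≠ c)
    (h3 : HCov p ends o u a₂ c b) : HCov p ends o a₁ a₂ c b :=
  HCov_root_leaf_u_of p ends hp hf hleaf h1u h12 h1c h1o h1b
    (T2_nonneg_coin p ends o a₂ c b u hp hf₁ hf₂ hb2 hba hbu hne hbo hbc) h3

end Theorem

end Coin

end RootLeafU

end Summit.Ventures.PercRepro2
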